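import Summits.ABC.IUTFork.Joshi.PrimitiveAnsatz
import Summits.ABC.IUTFork.Joshi.ArithTeichmullerSpace
import Mathlib.Topology.Metrizable.Basic
import HarnessLib

/-!
# Joshi, *ATS II (local prototype)* §§2–7, the REST of the block: holomorphoids (Def. 3.2.1), the Tate parameter
# function (Thm. 3.5.1), MOCHIZUKI'S ANSATZ `Σ_{𝔍(X,E)}` over the primitive one (Def. 6.11.1), its Galois/Frobenius
# stability (Prop. 6.13.1), Lem. 6.10.1, Cor. 6.3.1, the lift cosets of Rmk. 7.4.3 and Prop. 7.4.4 — over the landed carriers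

Record file of the abc-iut cell, branch E «type Joshi's construction, test vs S» (rung LADDER-ABC:A2.E; seat abc-iut-E-t2;
plan/E/ASSIGNMENTS.md row E-t2, E-PLAN R5/R12/R14). TAKES NO SIDE on [IUTchIII] Cor. 3.12, on Joshi's claims, or on Mochizuki's
report on them; typed ≠ proved ≠ endorsed. Source: K. Joshi, *Construction of Arithmetic Teichmuller Spaces II: Proof of a local
prototype of Mochizuki's Corollary 3.12*, arXiv:2303.01662 **v3** (UNREFEREED preprint; bib `Joshi2023ATS2Local`; cell render
`HOME/lit/renders/Joshi-arxiv-2303.01662/pNNNN.txt`, locators «p. N l. a–b» = PDF page N, render line), with the concordance to the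
earlier version arXiv:2111.04890 [J-II] (bib `Joshi2021ATS2`; my `Joshi/ATS2Ansatz.lean`, p428256) in each docstring.

CARRIERS (BY NAME, no duplication — E-PLAN R4a/R12): abc-iut-E-t3's `PeriodRingDatum` / `PrototypeDatum` (`Joshi/ThetaValuesLocus`,
`Joshi/PrimitiveAnsatz`: `F = ℂ_p^♭`, `B`, `|−|_ρ`, the points `Y`, residue fields `K y`, `η`, Tate modules `T y`, the point map
`pt`, `G`/`φ`-actions, the PRIMITIVE ANSATZ `primitiveAnsatz` of Def. 6.2.3 with Prop. 6.6.1/6.7.1/Thm. 6.9.1/Prop. 7.4.2 DERIVED there)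
and abc-iut-E-t1's `Untilt p` / `ATSObj X` (`Joshi/ArithTeichmullerSpace`: the objects `(Y/E′, E′ ↪ K, α)` of `𝔍(X,E)` over the
tree's `TemperedCurve p`). This file does NOT import OUR side (R14); our nearest objects are recorded by FQN in docstrings only.

## Contents (as printed ↦ as typed; SIGNATURE = data Joshi fixes, HYPOTHESIS = a statement print asserts, typed `def … : Prop`
## with `@[claim "Joshi2023ATS2Local" "disputed"]` and never asserted, DERIVED = a `theorem` proved from the carriers)

* Prop. 2.7.1 (p. 8 l. 58–112) = [J-II] §2 — the values `|−|_{K_y}` of ALL untilts are comparable in one value group: typed by the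
  carriers' choice of ONE real value group (`PeriodRingDatum.absK`, `Joshi.ATS2.Carrier.absAt`); `prop271_comparable` (DERIVED, `le_total`).
* Def. 3.2.1 (p. 9 l. 30–35) HOLOMORPHOID `(Y/E′, (E′ ↪ K, K^♭ ≃ F), ∗_K : 𝓜(K) → Y^an_{E′})` ↦ `Holomorphoid X D` = E-t1's `ATSObj X`
  + the base point + the closed classical point `y ∈ |𝒴_{F,ℚ_p}|` the untilt is («lying over `y`», Def. 6.11.1) with `K_y ≃ K`
  (SIGNATURE); Rmk. 3.2.2, §3.3–§3.4 in its docstring; Lem. 3.2.3 (p. 9 l. 50–53) ↦ `Holomorphoid.ofATS`, `nonempty_holomorphoid`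
  (DERIVED from E-t1's `ATSObj.nonempty` given a point datum).
* §3.5 + Thm. 3.5.1 (p. 10 l. 29 – p. 11 l. 48) THE TATE PARAMETER FUNCTION `A ↦ q(A) ∈ K_A^*` on `𝔍(X,E)` ↦ `TateParameter X`
  (SIGNATURE: (1)(2) = totality of the datum); (3) «non-constant» ↦ `TateParameter.NonConstant` (HYPOTHESIS, OUR READING);
  Rmk. 3.5.2 (p. 11 l. 49–56, «how to compare values of the Tate parameter function … in one common location … central to
  [IUTchIII, Cor. 3.12]») and §6.12.1–6.12.4 (p. 19 l. 41 – p. 20 l. 3, «there is no common topological field … neither this sum nor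
  the product makes sense») ↦ `tateValues`: a DEPENDENT tuple `(i : Fin ℓ⋆) → (A i).U.K` — the product is ill-typed BY CONSTRUCTION.
* Cor. 6.3.1 (p. 15 l. 66–89) `Σ̃_F ⊂ |𝒴|^{ℓ⋆}` metrisable ↦ `primitiveAnsatz_metrizable` (DERIVED from «`|𝒴_{F,ℚ_p}|` is a metric space
  [FF18, Prop. 2.3.2]» typed as instance hypotheses).
* Lem. 6.10.1 (p. 18 l. 11–38) = [J-II] §7 display «`p = [p^♭] = [(p^♭)^{2²}] = ⋯`» ↦ HYPOTHESIS `PeriodRingDatum.EtaPtTeich`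
  (`η_{K_{y_a}}([a]) = p`, [FF18, Déf. 2.2.1]: `y_a` is the zero of `[a] − p`) + `eta_teich_ansatzPt` (DERIVED); Rmk. 6.10.3 ↦
  `sumSqPt`; Rmk. 6.10.4 ↦ docstring + `MochizukiAnsatzNotTopIso` (HYPOTHESIS, over E-t1's `Untilt.TopIso`).
* Def. 6.11.1 (p. 19 l. 7–29) = [J-II] §7 «`𝔍^{Ansatz}_{ℂ_p^♭}`» — **MOCHIZUKI'S ANSATZ** `Σ_{𝔍(X,E)_{ℂ_p^♭}} ⊂ 𝔍(X,E)^{ℓ⋆}`: tuples of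
  anabelomorphic holomorphoids lying over a point of the Primitive Ansatz ↦ `mochizukiAnsatz` (definition over E-t3's
  `primitiveAnsatz`); Rmk. 6.11.3 (wide version: the carrier's `F` IS arbitrary); §6.13 forgetful functor ↦ `Holomorphoid.pts`;
  Prop. 6.13.1 (p. 20 l. 19–34) ↦ `galPts`/`frobPts` + `pts_gal_mem`/`pts_frob_mem` (DERIVED from E-t3's Prop. 6.6.1/6.7.1).
* Rmk. 7.4.3 (p. 21 l. 32–35) the lift cosets `T_y + [x]` ↦ `PeriodRingDatum.liftCoset`, `eta_of_mem_liftCoset` (DERIVED from `eta_T`),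
  «union … not closed under Frobenius» ↦ `LiftCosetsNotFrobStable` (HYPOTHESIS); Prop. 7.4.4 (p. 21 l. 36–54) = [J-II] §8 Prop.
  `pr:teichmuller-lift-B` «`|[x_j]|_ρ = |[x_1]|_ρ^{j²}`» ↦ `PrototypeDatum.norm_lift_ansatzPt_eq_pow_first` (DERIVED from E-t3's
  `norm_teich_lift` + `scale_ansatzPt`; the [J-II]-labelled twin is `Joshi.ATS2.Lifts.teichNorm_tuple_eq_pow_first`).

OUR-SIDE NEAREST OBJECTS (docstring record only, E-PLAN §3): arithmetic holomorphic structure ↔ a vertical line `(n,∘)` of the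
LGP-Gaussian log-theta-lattice (`Thm311.Situation.D n`, `Cor312.Setting.n`); Ansatz point ↔ the Θ×μ_LGP-link / third pin
`Cor312Vol.LinkPinned` (D-02; Joshi p. 19 l. 4–5 «Mochizuki's Primitive Ansatz leads to the construction of Θ_gau-Links»); Tate
parameter function ↔ `Literature.IUT.HodgeTheaters.InitialThetaData` q-parameters / `Cor312.Setting.qData.q`; «one common location»
(Rmk. 3.5.2) ↔ the mono-analytic packets `Thm311.LogShells.Packet` read through `ρ` (bridge typed in `Joshi/ATS2TestInterface`,
p428531); Galois/Frobenius symmetries ↔ `LogShells.Ind1Family` (D-04). [claim: Joshi2023ATS2Local, status: disputed]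
-/

noncomputable section

open Set

namespace Summit.ABC.IUTFork.Joshi

open Literature.AnabelianGeometry.SemiGraphs (TemperedCurve)

variable {F B E0 : Type} [Field F] [CommRing B] [Field E0] {Y : Type} {K : Y → Type} [∀ y, Field (K y)] {G : Type}

/-! ## 1. Prop. 2.7.1 — one value group for all untilts -/

namespace PeriodRingDatum

variable (D : PeriodRingDatum F B E0 Y K G)

/-- **Prop. 2.7.1 (p. 8 l. 64–83; = [J-II] §2 Prop. `pa:value-group-comp-loc`)**: «Let `K_1`, `K_2` be untilts of `ℂ_p^♭`. (1) Then
one has `|K_1^*| = |ℂ_p^{♭*}|`. (2) Hence … `K_1` and `K_2` have the same value group. (3) In particular, one can compare elements of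
`|K_1^*|` and `|K_2^*|` as elements of `|ℂ_p^{♭*}|`.» In the carrier this is the TYPE of `absK` (every `|−|_{K_y}` is valued in the
one ordered group `ℝ`), so (3) is a theorem of the typing: any two values are comparable. DERIVED (bookkeeping).
[claim: Joshi2023ATS2Local, status: disputed] -/
theorem prop271_comparable (y₁ y₂ : Y) (z₁ : K y₁) (z₂ : K y₂) :
    D.absK y₁ z₁ ≤ D.absK y₂ z₂ ∨ D.absK y₂ z₂ ≤ D.absK y₁ z₁ :=
  le_total _ _

/-! ## 2. Lem. 6.10.1 — «`p = [p^♭] = [(p^♭)^{2²}] = ⋯`», Rmk. 6.10.3, and the lift cosets of Rmk. 7.4.3 -/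

/-- **The zero of `[a] − p`** ([FF18, Déf. 2.2.1] as used in §6.10, p. 18 l. 12–15: «one can choose a primitive element of degree one
of `([p^♭] − p) ⊂ W(𝒪_F)` which generates the prime ideal `ker(η_K : W(𝒪_F) ↠ 𝒪_K)` defining the point `y_1`»): at the point `y_a`
of `[a] − p` one has `η_{K_{y_a}}([a]) = p`, for `0 ≠ a ∈ 𝔪_F`. HYPOTHESIS on the carrier (E-t3's `PeriodRingDatum` records
`|p|_{K_{y_a}} = |a|_F`, not this identity), named, never asserted. [claim: Joshi2023ATS2Local, status: disputed] -/
@[claim "Joshi2023ATS2Local" "disputed"]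
def EtaPtTeich : Prop := ∀ a : F, a ≠ 0 → D.absF a < 1 → D.eta (D.pt a) (D.teich a) = (D.p : K (D.pt a))

/-- **Rmk. 6.10.3 (p. 18 l. 39–54)**: «I use the projection to the first coordinate `Σ̃ ⊂ 𝒴^{ℓ⋆} → 𝒴` for valuation computations.
There are also more complicated (and highly non-algebraic) maps … for example `([a]−p, …, [a^{ℓ⋆²}]−p) ↦ [a^{Σ_j j²}] − p`»: the point
of the printed example. DEFINITION (as printed). [claim: Joshi2023ATS2Local, status: disputed] -/
def sumSqPt (n : ℕ) (a : F) : Y := D.pt (a ^ ∑ i : Fin n, ((i : ℕ) + 1) ^ 2)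

/-- **Rmk. 7.4.3 (p. 21 l. 32–33), the lift coset `T_y + [x]`**: «Let `[x]` be a lift of `ξ` to `B` with `η_{K_y}([x]) = ξ`. Then one is
interested in bounds for `|[x]|_ρ = |ξ|_{K_y}`. The idea is to instead consider bounds for elements of `T_y + [x]`.» DEFINITION.
[claim: Joshi2023ATS2Local, status: disputed] -/
def liftCoset (y : Y) (x : F) : Set B := {b | ∃ τ ∈ D.T y, b = τ + D.teich x}

/-- `[x] ∈ T_y + [x]` (`0 ∈ T_y`). [folklore] -/
theorem teich_mem_liftCoset (y : Y) (x : F) : D.teich x ∈ D.liftCoset y x :=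
  ⟨0, D.zero_mem_T y, by rw [zero_add]⟩

/-- Every element of `T_y + [x]` lifts `η_{K_y}([x])` (Prop. 7.4.2 (3): «for any `τ ∈ T_y ⊂ B^{φ=p}` one has `η_{K_y}(τ + [x]) = ξ`»,
«immediate from the fact that `ker(η_{K_y}) ⊃ T_y`»). DERIVED from `eta_T`. [claim: Joshi2023ATS2Local, status: disputed] -/
theorem eta_of_mem_liftCoset {y : Y} {x : F} {b : B} (hb : b ∈ D.liftCoset y x) : D.eta y b = D.eta y (D.teich x) := by
  obtain ⟨τ, hτ, rfl⟩ := hb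
  rw [map_add, D.eta_T y τ hτ, zero_add]

/-- The union of the lift cosets of ALL Teichmüller lifts of a given `ξ ∈ K_y` (Rmk. 7.4.3: «union of all such lifts `T_y + [x]` of
`ξ`»). DEFINITION. [claim: Joshi2023ATS2Local, status: disputed] -/
def liftsOf (y : Y) (ξ : K y) : Set B := ⋃ x ∈ {x : F | D.eta y (D.teich x) = ξ}, D.liftCoset y x

/-- Every element of the union lifts `ξ`. DERIVED. [folklore] -/
theorem eta_of_mem_liftsOf {y : Y} {ξ : K y} {b : B} (hb : b ∈ D.liftsOf y ξ) : D.eta y b = ξ := by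
  obtain ⟨x, hx, hb⟩ := Set.mem_iUnion₂.1 hb
  rw [D.eta_of_mem_liftCoset hb]
  exact hx

/-- **Rmk. 7.4.3 (p. 21 l. 34–35)**: «Note that union of all such lifts `T_y + [x]` of `ξ` is not closed under Frobenius. So one needs to
enlarge the locus to be Frobenius stable [§8, E-t3's `thetaLocus`] and then consider its intersection with `B^{φ=p}`.» HYPOTHESIS
(named, never asserted): some union of lift cosets is not `φ`-stable. [claim: Joshi2023ATS2Local, status: disputed] -/
@[claim "Joshi2023ATS2Local" "disputed"]
def LiftCosetsNotFrobStable : Prop := ∃ (y : Y) (ξ : K y), ¬ (D.frob '' D.liftsOf y ξ ⊆ D.liftsOf y ξ)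

end PeriodRingDatum

namespace PrototypeDatum

variable (P : PrototypeDatum F B E0 Y K G)

/-- **Lem. 6.10.1 (p. 18 l. 11–38; = [J-II] §7, the display after eq-canonical-tuple)**: «every point of `Σ̃_F` provides a version of
Mochizuki's ansatz … `p ↦ ([p^♭], [(p^♭)^{2²}], ⋯, [(p^♭)^{ℓ⋆²}])`», i.e. «`p = [p^♭] = [(p^♭)^{2²}] = ⋯ = [(p^♭)^{ℓ⋆²}]`» read in the
respective residue fields: at the `j`-th point of the tuple of `a`, `η_{K_{y_j}}([a^{j²}]) = p`. DERIVED from the hypothesis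
`EtaPtTeich` (the valuation-scaling half is E-t3's `scale_ansatzPt`, Thm. 6.9.1). [claim: Joshi2023ATS2Local, status: disputed] -/
theorem eta_teich_ansatzPt (h : P.EtaPtTeich) {a : F} (ha : a ∈ P.AnsatzParam) (i : Fin P.lstar) :
    P.eta (P.ansatzPt a i) (P.teich (a ^ ((i : ℕ) + 1) ^ 2)) = (P.p : K (P.ansatzPt a i)) := by
  have hp := P.pow_mem_ansatzParam ha (n := ((i : ℕ) + 1) ^ 2) (by positivity)
  exact h _ hp.1 hp.2

/-- **Cor. 6.3.1 (p. 15 l. 66–89)**: «`Σ̃_F` viewed as a subset of `|𝒴_{F,ℚ_p}|^{ℓ⋆}` is metrisable. Proof. … the set of closed classical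
points `|𝒴_{F,ℚ_p}|` is a metric space by [Fargues–Fontaine, Prop. 2.3.2] and hence `|𝒴|^{ℓ⋆}` is metrisable and so `Σ̃_F` may be
equipped with a metric induced from `|𝒴|^{ℓ⋆}`.» DERIVED, with [FF18, Prop. 2.3.2] typed as the instance hypotheses (no bearing
on S). [claim: Joshi2023ATS2Local, status: disputed] -/
theorem primitiveAnsatz_metrizable [TopologicalSpace Y] [TopologicalSpace.MetrizableSpace Y] :
    TopologicalSpace.MetrizableSpace {y : Fin P.lstar → Y // y ∈ P.primitiveAnsatz} :=
  inferInstance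

/-- **Prop. 7.4.4 (p. 21 l. 36–54; = [J-II] §8 Prop. `pr:teichmuller-lift-B`)**: «Let `[x_j] ∈ W(𝒪_{ℂ_p^♭}) ⊂ B` be a Teichmuller lift of
`ξ_1` under `η_{K_j}` … Then one has `|[x_j]|_ρ = |[x_1]|_ρ^{j²}`. Proof. … `|[x_j]|_ρ = |ξ_1|_{K_j} = |ξ_1|^{j²}_{K_1} = |[x_1]|^{j²}_ρ`.»
DERIVED over E-t3's carrier (`norm_teich_lift`, `scale_ansatzPt`); the [J-II]-labelled twin over my carrier is
`Joshi.ATS2.Lifts.teichNorm_tuple_eq_pow_first` (p428256). [claim: Joshi2023ATS2Local, status: disputed] -/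
theorem norm_lift_ansatzPt_eq_pow_first {a : F} (ha : a ∈ P.AnsatzParam) {ρ : ℝ} (hρ : 0 < ρ) (hρ1 : ρ ≤ 1)
    (i i₁ : Fin P.lstar) (hi₁ : (i₁ : ℕ) = 0) {x x₁ : F} (hx : P.eta (P.ansatzPt a i) (P.teich x) = P.emb _ P.xi)
    (hx₁ : P.eta (P.ansatzPt a i₁) (P.teich x₁) = P.emb _ P.xi) :
    P.norm ρ (P.teich x) = P.norm ρ (P.teich x₁) ^ ((i : ℕ) + 1) ^ 2 := by
  rw [P.norm_teich_lift hρ hρ1 hx, P.norm_teich_lift hρ hρ1 hx₁, P.scale_ansatzPt ha i, P.scale_ansatzPt ha i₁, hi₁,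
    ← Real.rpow_natCast, ← Real.rpow_mul P.abs0_xi_pos.le]
  congr 1
  push_cast
  ring

end PrototypeDatum

/-! ## 3. Def. 3.2.1 — holomorphoids over E-t1's `𝔍(X,E)` objects, and the Tate parameter function (Thm. 3.5.1) -/

variable {p : ℕ} [Fact p.Prime]

/-- **Def. 3.2.1 (p. 9 l. 30–35) — HOLOMORPHOID.** «I will refer to the data `(Y/E′, (E′ ↪ K, K^♭ ≃ F), ∗_K : 𝓜(K) → Y^an_{E′})` as an
arithmetic holomorphic structure on `Y/E′` or simply as an arithmetic holomorphoid of `Y/E′` … Any holomorphoid of `Y/E′` which is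
(tempered) anabelomorphic to `X/E` … will be referred to as an anabelomorphic holomorphoid of `X/E`.» Typed OVER the landed carriers:
the triple `(Y/E′, E′ ↪ K, α : Π^temp(Y/E′) ≅ Π^temp(X/E))` is abc-iut-E-t1's `ATSObj X` ([J-I] §8); datum (3) of §3.1, the geometric
point `∗_K : 𝓜(K) → Y^an_{E′}` (p. 9 l. 18), is an abstract pointed type; the tilt datum `K^♭ ≃ F` is recorded as the closed classical
point `y ∈ |𝒴_{F,ℚ_p}|` of abc-iut-E-t3's carrier the untilt corresponds to ([FF18]: degree-one points ↔ untilts; Def. 6.11.1 «lying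
over `y_j`») with a field identification `K_y ≅ K`. Rmk. 3.2.2 (p. 9 l. 36–48): «provides analytic spaces `Y^an_{E′}` and `Y^an_K` …
the geometric analytic or holomorphic functions provided by this holomorphoid»; §3.3 short notation `(Y/E′, E′ ↪ K)`; §3.4 (p. 10
l. 1–28): for the elliptic cyclops `X = C − {O}` of strict Belyi type `Y ≅ X` as `ℤ`-schemes. SIGNATURE; nothing asserted. OUR nearest
object (record only): a vertical line `(n,∘)` of the log-theta-lattice, `Thm311.Situation.D n`. [claim: Joshi2023ATS2Local, status: disputed] -/
structure Holomorphoid (X : TemperedCurve p) (D : PeriodRingDatum F B E0 Y K G) : Type 1 where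
  /-- the object `(Y/E′, E′ ↪ K, α)` of `𝔍(X,E)` ([J-I] §8; E-t1) -/
  toATS : ATSObj X
  /-- the type of geometric points `𝓜(K) → Y^an_{E′}` (datum (3) of §3.1) -/
  BasePt : Type
  /-- the chosen geometric point `∗_K` -/
  basePt : BasePt
  /-- the closed classical point `y ∈ |𝒴_{F,ℚ_p}|` the untilt `(K, K^♭ ≃ F)` corresponds to -/
  pt : Y
  /-- `K_y ≅ K`: the residue field of `y` IS the holomorphoid's perfectoid field -/
  res : K pt ≃+* toATS.U.K

namespace Holomorphoid

variable {X : TemperedCurve p} {D : PeriodRingDatum F B E0 Y K G}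

/-- **Lem. 3.2.3 (p. 9 l. 50–53), the constructor**: an object of `𝔍(X,E)` together with a point datum IS a holomorphoid (the
point-free part «`(X/E, (↪ K, K^♭ ≃ F), ∗_K)` is an anabelomorphic holomorphoid of `X/E`» is E-t1's `ATSObj.self`).
[claim: Joshi2023ATS2Local, status: disputed] -/
def ofATS (A : ATSObj X) (y : Y) (e : K y ≃+* A.U.K) : Holomorphoid X D := ⟨A, Unit, (), y, e⟩

/-- **Lem. 3.2.3**: «the arithmetic Teichmuller space `𝔍(X,E)` is the space of all anabelomorphic holomorphoids of `X/E`» — every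
holomorphoid has an underlying object of `𝔍(X,E)` and every object with a point datum is one; in particular holomorphoids exist as
soon as some residue field `K_y` is identified with some untilt receiving an object (E-t1's `ATSObj.nonempty` supplies
`(X/E, E ↪ ℂ_p, id)`). DERIVED. [claim: Joshi2023ATS2Local, status: disputed] -/
theorem nonempty_holomorphoid (h : ∃ (A : ATSObj X) (y : Y), Nonempty (K y ≃+* A.U.K)) : Nonempty (Holomorphoid X D) := by
  obtain ⟨A, y, ⟨e⟩⟩ := h
  exact ⟨ofATS A y e⟩

/-- §6.13 (p. 20 l. 4–18) «there is a "forget-all-the-base-points" functor» — and, one step further, the underlying POINT: the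
holomorphoid `(X/E, (↪ K_{y}, K^♭_y ≃ F))` over `y` is determined by `y`. [claim: Joshi2023ATS2Local, status: disputed] -/
def pts {n : ℕ} (A : Fin n → Holomorphoid X D) : Fin n → Y := fun i => (A i).pt

end Holomorphoid

/-- **§3.5 + Thm. 3.5.1 (p. 10 l. 29 – p. 11 l. 48) — THE TATE PARAMETER FUNCTION on `𝔍(X,E)`.** «one may associate to the holomorphoid
… a Tate parameter … `q_{C;K} ∈ K^*` … the Tate parameter can be viewed as a function (in the sense this term is used in algebraic
geometry) on `𝔍(X,E)`»; Thm. 3.5.1: «(1) If `X/E` has potentially multiplicative reduction, then every … object of `𝔍(X,E)` has this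
property. (2) Hence the Tate parameter … provides a function … `(Y/E′, (E′ ↪ K, …)) ↦ q_{(…)} ∈ K^*`. (3) … the Tate parameter is a
non-constant function on `𝔍(X,E)`». SIGNATURE: (1)–(2) ARE the totality of the datum `q` (a value in EACH object's own field `K`,
nonzero, in `𝔪_K`); (3) is the named `Prop` `NonConstant`. OUR nearest objects (record only): the q-parameters of [IUTchI] Def. 3.1 (b)
(`Literature.IUT.HodgeTheaters.InitialThetaData`), the q-pilot datum `Cor312.Setting.qData.q`. [claim: Joshi2023ATS2Local, status: disputed] -/
structure TateParameter (X : TemperedCurve p) : Type 1 where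
  /-- `A ↦ q(A) ∈ K_A` -/
  q : ∀ A : ATSObj X, A.U.K
  /-- `q(A) ∈ K_A^*` -/
  q_ne_zero : ∀ A, q A ≠ 0
  /-- `q(A) ∈ 𝔪_{K_A}` (a Tate parameter) -/
  norm_q_lt_one : ∀ A, ‖q A‖ < 1

namespace TateParameter

variable {X : TemperedCurve p} (τ : TateParameter X)

/-- **Thm. 3.5.1 (3) (p. 11 l. 1–4)** «as arithmetic holomorphic structures may not be comparable, the Tate parameter is a non-constant
function on `𝔍(X,E)` and this is true even if one works with `𝔍(X,E)_{ℂ_p^♭}`» — OUR READING (print does not define «non-constant» for a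
function with values in varying fields): there are two objects such that NO topological isomorphism of their perfectoid fields
carries one value to the other. HYPOTHESIS, named, never asserted. [claim: Joshi2023ATS2Local, status: disputed] -/
@[claim "Joshi2023ATS2Local" "disputed"]
def NonConstant : Prop := ∃ A A' : ATSObj X, ∀ e : A.U.TopEquiv A'.U, e.toRingEquiv (τ.q A) ≠ τ.q A'

/-- **Rmk. 3.5.2 (p. 11 l. 49–56) and §6.12.3–6.12.4 (p. 19 l. 63 – p. 20 l. 3)**: «A central question … is how to compare values of the
Tate parameter function on `𝔍(X,E)` in one common location. This question is also central to [IUTchIII, Corollary 3.12]»; «one wants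
to replace the formal sum [`Σ_j [A_j]`, the Ansatz point as a divisorial correspondence, §6.12.1] by … `∏_{j=1}^{ℓ⋆} q(A_j)` … However
… there is no common topological field in which one can view the individual terms of the above sum or product. Hence neither this sum
nor the product makes sense. This fundamental problem is resolved in §7 [lifting to `B`].» TYPED AS PRINTED: the values of the Tate
parameter function along a tuple form a DEPENDENT tuple — the `i`-th value lives in the `i`-th object's own field, so no product of
them typechecks; the common location is supplied only by the lifts to `B` (E-t3's `norm_teich_lift`, my `Joshi.ATS2.Lifts`). OUR
common location (record only): the mono-analytic packets `Thm311.LogShells.Packet` read through `ρ`; the typed bridge is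
`Joshi.ATS2.PilotReading` (p428531). [claim: Joshi2023ATS2Local, status: disputed] -/
def tateValues {D : PeriodRingDatum F B E0 Y K G} {n : ℕ} (A : Fin n → Holomorphoid X D) : (i : Fin n) → (A i).toATS.U.K :=
  fun i => τ.q (A i).toATS

/-- Each value of the Tate parameter function along a tuple is nonzero in its own field. [folklore] -/
theorem tateValues_ne_zero {D : PeriodRingDatum F B E0 Y K G} {n : ℕ} (A : Fin n → Holomorphoid X D) (i : Fin n) :
    τ.tateValues A i ≠ 0 :=
  τ.q_ne_zero _

end TateParameter

/-! ## 4. Def. 6.11.1 — MOCHIZUKI'S ANSATZ `Σ_{𝔍(X,E)}` over the Primitive Ansatz; Prop. 6.13.1 -/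

section Ansatz

variable (X : TemperedCurve p) (P : PrototypeDatum F B E0 Y K G)

/-- **Def. 6.11.1 (p. 19 l. 7–29) — MOCHIZUKI'S ANSATZ** (= [J-II] §7, the category `𝔍^{Ansatz}_{ℂ_p^♭} → Perf^{ℓ⋆}_{ℂ_p^♭}`): «Mochizuki's
Ansatz is the full subcategory `Σ_{𝔍(X,E)_{ℂ_p^♭}}` of the product `𝔍(X,E)^{ℓ⋆}_{ℂ_p^♭}` whose set of objects consists of `ℓ⋆`-tuples of
arithmetic holomorphic structures of the form `(X/E, (↪ K_{y_j}, K^♭_{y_j} ≃ ℂ_p^♭), ∗_{K_{y_j}} : 𝓜(K_{y_j}) → X^an_E)_{j=1,…,ℓ⋆}` where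
`(y_1, …, y_{ℓ⋆}) ∈ Σ̃_F` i.e. … the set of `ℓ⋆`-tuples of anabelomorphic holomorphoids of `X/E` lying over some point `(y_1, …, y_{ℓ⋆})`
of Mochizuki's Primitive Ansatz» (p. 19 l. 4–5: «Mochizuki's Primitive Ansatz leads to the construction of Θ_gau-Links of
[IUTchIII]»). DEFINITION over E-t3's `primitiveAnsatz` (Def. 6.2.3) and `Holomorphoid`. Rmk. 6.11.3 (p. 19 l. 30–40): the wide version
over an arbitrary algebraically closed perfectoid `F` — the carrier's `F` IS arbitrary, `ℂ_p^♭` being one instantiation. OUR nearest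
object (record only): the Θ×μ_LGP-link pin `Cor312Vol.LinkPinned` / a lattice column (E-PLAN D-02). [claim: Joshi2023ATS2Local, status: disputed] -/
def mochizukiAnsatz : Set (Fin P.lstar → Holomorphoid X P.toPeriodRingDatum) :=
  {A | Holomorphoid.pts A ∈ P.primitiveAnsatz}

variable {X P}

/-- Membership unfolded: a tuple of holomorphoids is an Ansatz object iff its point tuple is a Primitive-Ansatz tuple. [folklore] -/
theorem mem_mochizukiAnsatz_iff (A : Fin P.lstar → Holomorphoid X P.toPeriodRingDatum) :
    A ∈ mochizukiAnsatz X P ↔ ∃ a ∈ P.AnsatzParam, Holomorphoid.pts A = P.ansatzPt a :=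
  Iff.rfl

/-- The `G`-translate of a point tuple (Prop. 6.13.1: «`(X/E, (↪ K_{y_j}, …))_j` is mapped to `(X/E, (↪ K_{σ(y_j)}, …))_j`», for
`σ ∈ G_{ℚ_p}`). DEFINITION. [claim: Joshi2023ATS2Local, status: disputed] -/
def galPts (D : PeriodRingDatum F B E0 Y K G) (g : G) {n : ℕ} (y : Fin n → Y) : Fin n → Y := fun i => D.galY g (y i)

/-- The Frobenius translate of a point tuple (Prop. 6.13.1, `σ ∈ φ^ℤ`). DEFINITION. [claim: Joshi2023ATS2Local, status: disputed] -/
def frobPts (D : PeriodRingDatum F B E0 Y K G) {n : ℕ} (y : Fin n → Y) : Fin n → Y := fun i => D.frobY (y i)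

/-- **Prop. 6.13.1 (p. 20 l. 19–34), Galois part**: «There is a natural action of `G_{ℚ_p}` … on the tuples `(X/E, (↪ K_{y_j},
K^♭_{y_j} ≃ ℂ_p^♭))_{j}` given as follows … mapped to `(X/E, (↪ K_{σ(y_j)}, …))_j`» — typed in the forgetful form of §6.13 (the tuple
with base points forgotten is determined by its points): the `G`-translate of the point tuple of an Ansatz object is again a
Primitive-Ansatz tuple. DERIVED from E-t3's `primitiveAnsatz_gal` (Prop. 6.7.1). OUR nearest object (record only):
`Thm311.LogShells.Ind1Family` (D-04). [claim: Joshi2023ATS2Local, status: disputed] -/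
theorem pts_gal_mem (g : G) {A : Fin P.lstar → Holomorphoid X P.toPeriodRingDatum} (hA : A ∈ mochizukiAnsatz X P) :
    galPts P.toPeriodRingDatum g (Holomorphoid.pts A) ∈ P.primitiveAnsatz :=
  P.primitiveAnsatz_gal g hA

/-- **Prop. 6.13.1, Frobenius part** («and Frobenius `φ` of `𝒴_{ℂ_p^♭,ℚ_p}` …, for any `σ ∈ φ^ℤ`»): the Frobenius translate of the
point tuple of an Ansatz object is a Primitive-Ansatz tuple. DERIVED from E-t3's `primitiveAnsatz_frob` (Prop. 6.6.1).
[claim: Joshi2023ATS2Local, status: disputed] -/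
theorem pts_frob_mem {A : Fin P.lstar → Holomorphoid X P.toPeriodRingDatum} (hA : A ∈ mochizukiAnsatz X P) :
    frobPts P.toPeriodRingDatum (Holomorphoid.pts A) ∈ P.primitiveAnsatz :=
  P.primitiveAnsatz_frob hA

/-- Iterated Frobenius translates stay in the Primitive Ansatz (`σ ∈ φ^ℕ ⊂ φ^ℤ`). DERIVED. [folklore] -/
theorem pts_frob_iterate_mem (k : ℕ) {A : Fin P.lstar → Holomorphoid X P.toPeriodRingDatum} (hA : A ∈ mochizukiAnsatz X P) :
    (frobPts P.toPeriodRingDatum)^[k] (Holomorphoid.pts A) ∈ P.primitiveAnsatz := by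
  induction k with
  | zero => exact hA
  | succ k ih =>
    rw [Function.iterate_succ_apply']
    exact P.primitiveAnsatz_frob ih

/-- **Rmk. 6.10.4 (p. 18 l. 55–63)**: «The set `Σ̃_{ℂ_p^♭}` … should be viewed as providing arithmetic Kodaira Spencer classes … these
are non-trivial because as one moves over `Σ̃_{ℂ_p^♭}` …, the analytic spaces `X^an_{K_1}, …, X^an_{K_{ℓ⋆}}` need not be topologically
isomorphic in general» (Thm. 6.9.1 (4) [Kedlaya–Temkin]; Rmk. 4.1.1, p. 12 l. 38–43: then «the analytic function theories of `C^an_{K_1}`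
and `C^an_{K_2}` are not isomorphic», [J-I] Thm. 3.15.1). HYPOTHESIS over E-t1's `Untilt.TopIso`, named, never asserted: some Ansatz
object has two entries with non-homeomorphic perfectoid fields. [claim: Joshi2023ATS2Local, status: disputed] -/
@[claim "Joshi2023ATS2Local" "disputed"]
def MochizukiAnsatzNotTopIso (X : TemperedCurve p) (P : PrototypeDatum F B E0 Y K G) : Prop :=
  ∃ A ∈ mochizukiAnsatz X P, ∃ i i' : Fin P.lstar, ¬ (A i).toATS.U.TopIso (A i').toATS.U

/-- An Ansatz object whose entries have pairwise non-homeomorphic fields has pairwise NON-ISOMORPHIC underlying `𝔍(X,E)`-objects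
(E-t1's `ATSObj.not_isIso_of_not_topIso`: isomorphisms of triples are topological on `K`). DERIVED. [folklore] -/
theorem not_isIso_of_not_topIso {A : Fin P.lstar → Holomorphoid X P.toPeriodRingDatum} {i i' : Fin P.lstar}
    (h : ¬ (A i).toATS.U.TopIso (A i').toATS.U) : ¬ (A i).toATS.IsIso (A i').toATS :=
  ATSObj.not_isIso_of_not_topIso h

end Ansatz

end Summit.ABC.IUTFork.Joshi

end
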